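import Mathlib
import Summits.Ventures.DiscreteObjects.Mahler.CensusTrigCuts
import Summits.Ventures.DiscreteObjects.Mahler.LehmerLowerBound

/-!
# Resultant power-sum cuts, I: the Laurent identity and the defect bound (venture `DiscreteObjects`, target L)

Cell `pub-namedobj`, seat `pub-namedobj-mahler-g14`. Framing: lottery ticket; floor = certified bounds/negative
ranges.

Pointwise ingredients of the resultant (arithmetic) cuts of `CensusResultantCuts`, for a real vector `v = (v₀,…,v_L)`,
`V(z) = Σ_j v_j z^j` (`vEval`) with autocorrelations `λ₀, λ_k` (`lamZero`, `lamAt`) and `q̂(α) := V(α)·V(α⁻¹)`: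

* `laurent_vEval`: `V(z)V(z⁻¹) = λ₀ + Σ_{k≥1} (λ_k/2)(z^k + z^{-k})` (`z ≠ 0`);
* `norm_sub_re_laurent_le`: `‖q̂(α)‖ - Re q̂(α) ≤ ½ κ_m(max(‖α‖,‖α‖⁻¹))²` for every shift `m`, where
  `κ_m(v; R) = Σ_j |v_j| (R^{|j-m|} - R^{-|j-m|})` (`kappaR`): write `q̂(α) = a·conj b` with `a = V(α)`,
  `b = V(1/conj α)`, use `‖a‖‖b‖ - Re(a conj b) ≤ ½‖aγ - bγ'‖²` for `γ conj γ' = 1` (`γ = α^{-m}`, `γ' = conj α^m`) and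
  `‖w - conj(w⁻¹)‖ = |‖w‖ - ‖w‖⁻¹|`;
* `kappaR` is nonnegative, monotone and superadditive on `[1, ∞)`, so `Σ_α κ(R_α)² ≤ κ(∏ R_α)²`
  (`sum_kappaR_sq_le`) — the slack of the cut is `κ_m(M)² ≤ κ_m(B)²`.
-/

namespace Summit.Ventures.DiscreteObjects.Mahler

open Polynomial

/-! ## `vEval` as a finite sum; conjugation; the Laurent identity -/

/-- `V(z) = Σ_{j<|v|} v_j z^j`. -/
theorem vEval_eq_sum (v : List ℝ) (z : ℂ) :
    vEval v z = ∑ j ∈ Finset.range v.length, ((v.getD j 0 : ℝ) : ℂ) * z ^ j := by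
  induction v with
  | nil => simp [vEval]
  | cons a w ih =>
    rw [vEval, ih, List.length_cons, Finset.sum_range_succ', List.getD_cons_zero, pow_zero, mul_one, add_comm,
      Finset.mul_sum]
    congr 1
    apply Finset.sum_congr rfl
    intro j _
    rw [List.getD_cons_succ, pow_succ]; ring

/-- `conj V(z) = V(conj z)` (real coefficients). -/
theorem conj_vEval (v : List ℝ) (z : ℂ) : (starRingEnd ℂ) (vEval v z) = vEval v ((starRingEnd ℂ) z) := by
  induction v with
  | nil => simp [vEval]
  | cons a w ih => rw [vEval, vEval, map_add, map_mul, Complex.conj_ofReal, ih]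

/-- `z^m · V_w(z) = Σ_k w_k z^{m+k}` (complex form of `re_pow_mul_vEval`). -/
theorem pow_mul_vEval (w : List ℝ) (z : ℂ) (m : ℕ) :
    z ^ m * vEval w z = ∑ k ∈ Finset.range w.length, ((w.getD k 0 : ℝ) : ℂ) * z ^ (m + k) := by
  rw [vEval_eq_sum, Finset.mul_sum]
  apply Finset.sum_congr rfl
  intro k _
  rw [pow_add]; ring

/-- **Laurent identity.** For `z ≠ 0`: `V(z)·V(z⁻¹) = λ₀ + Σ_{k≥1} (λ_k/2)(z^k + z^{-k})`. -/
theorem laurent_vEval (v : List ℝ) {z : ℂ} (hz : z ≠ 0) :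
    vEval v z * vEval v z⁻¹ =
      ((lamZero v : ℝ) : ℂ) + ∑ k ∈ Finset.range v.length, ((lamAt v (k + 1) / 2 : ℝ) : ℂ) * (z ^ (k + 1) + z⁻¹ ^ (k + 1)) := by
  induction v with
  | nil => simp [vEval, lamZero]
  | cons a w ih =>
    have hE : vEval (a :: w) z * vEval (a :: w) z⁻¹ =
        (a : ℂ) * a + vEval w z * vEval w z⁻¹ + (a : ℂ) * (z * vEval w z + z⁻¹ * vEval w z⁻¹) := by
      rw [vEval, vEval]
      have : z * vEval w z * (z⁻¹ * vEval w z⁻¹) = vEval w z * vEval w z⁻¹ := by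
        field_simp
      linear_combination this
    rw [hE, ih, lamZero_cons, List.length_cons, Finset.sum_range_succ, lamAt_cons_succ a w w.length,
      List.getD_eq_default _ _ le_rfl, lamAt_eq_zero_of_le w (Nat.le_succ _), mul_zero, zero_add, zero_div,
      Complex.ofReal_zero, zero_mul, add_zero, Complex.ofReal_add, Complex.ofReal_mul]
    have hsplit : ∑ k ∈ Finset.range w.length, ((lamAt (a :: w) (k + 1) / 2 : ℝ) : ℂ) * (z ^ (k + 1) + z⁻¹ ^ (k + 1)) =
        (a : ℂ) * ∑ k ∈ Finset.range w.length, ((w.getD k 0 : ℝ) : ℂ) * (z ^ (1 + k) + z⁻¹ ^ (1 + k)) +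
          ∑ k ∈ Finset.range w.length, ((lamAt w (k + 1) / 2 : ℝ) : ℂ) * (z ^ (k + 1) + z⁻¹ ^ (k + 1)) := by
      rw [Finset.mul_sum, ← Finset.sum_add_distrib]
      apply Finset.sum_congr rfl
      intro k _
      rw [lamAt_cons_succ, show 1 + k = k + 1 from Nat.add_comm 1 k]
      push_cast; ring
    rw [hsplit]
    have hmix : z * vEval w z + z⁻¹ * vEval w z⁻¹ =
        ∑ k ∈ Finset.range w.length, ((w.getD k 0 : ℝ) : ℂ) * (z ^ (1 + k) + z⁻¹ ^ (1 + k)) := by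
      have h1 := pow_mul_vEval w z 1
      have h2 := pow_mul_vEval w z⁻¹ 1
      rw [pow_one] at h1 h2
      rw [h1, h2, ← Finset.sum_add_distrib]
      apply Finset.sum_congr rfl
      intro k _; rw [inv_pow]; ring
    rw [hmix]; push_cast; ring

/-! ## The defect `‖q̂‖ - Re q̂` -/

/-- `‖w - conj(w⁻¹)‖ = |‖w‖ - ‖w‖⁻¹|` for `w ≠ 0`. -/
theorem norm_sub_conj_inv {w : ℂ} (hw : w ≠ 0) :
    ‖w - (starRingEnd ℂ) w⁻¹‖ = |‖w‖ - ‖w‖⁻¹| := by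
  have hn : 0 < ‖w‖ := norm_pos_iff.mpr hw
  have hconj : (starRingEnd ℂ) w⁻¹ = (((‖w‖ ^ 2)⁻¹ : ℝ) : ℂ) * w := by
    rw [Complex.inv_def, map_mul, Complex.conj_conj, Complex.conj_ofReal, Complex.normSq_eq_norm_sq, mul_comm]
  have hfac : w - (starRingEnd ℂ) w⁻¹ = (((1 - (‖w‖ ^ 2)⁻¹ : ℝ)) : ℂ) * w := by
    rw [hconj]; push_cast; ring
  have key : (1 - (‖w‖ ^ 2)⁻¹) * ‖w‖ = ‖w‖ - ‖w‖⁻¹ := by field_simp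
  rw [hfac, norm_mul, Complex.norm_real, Real.norm_eq_abs, ← key, abs_mul, abs_of_pos hn]

/-- `‖a‖‖b‖ - Re(a conj b) ≤ ½ ‖aγ - bγ'‖²` whenever `γ conj γ' = 1`. -/
theorem norm_mul_norm_sub_re_le (a b γ γ' : ℂ) (h : γ * (starRingEnd ℂ) γ' = 1) :
    ‖a‖ * ‖b‖ - (a * (starRingEnd ℂ) b).re ≤ ‖a * γ - b * γ'‖ ^ 2 / 2 := by
  have hγ : ‖γ‖ * ‖γ'‖ = 1 := by
    have := congrArg norm h
    rwa [norm_mul, Complex.norm_conj, norm_one] at this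
  set x := a * γ with hx
  set y := b * γ' with hy
  have h1 : ‖x‖ * ‖y‖ = ‖a‖ * ‖b‖ := by
    rw [hx, hy, norm_mul, norm_mul]
    calc ‖a‖ * ‖γ‖ * (‖b‖ * ‖γ'‖) = ‖a‖ * ‖b‖ * (‖γ‖ * ‖γ'‖) := by ring
      _ = ‖a‖ * ‖b‖ := by rw [hγ, mul_one]
  have h2 : (x * (starRingEnd ℂ) y).re = (a * (starRingEnd ℂ) b).re := by
    rw [hx, hy, map_mul]
    have : a * γ * ((starRingEnd ℂ) b * (starRingEnd ℂ) γ') = a * (starRingEnd ℂ) b * (γ * (starRingEnd ℂ) γ') := by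
      ring
    rw [this, h, mul_one]
  rw [← h1, ← h2]
  have h3 : ‖x - y‖ ^ 2 = ‖x‖ ^ 2 + ‖y‖ ^ 2 - 2 * (x * (starRingEnd ℂ) y).re := by
    rw [← Complex.normSq_eq_norm_sq, ← Complex.normSq_eq_norm_sq, ← Complex.normSq_eq_norm_sq, Complex.normSq_sub]
  rw [h3]
  nlinarith [sq_nonneg (‖x‖ - ‖y‖), norm_nonneg x, norm_nonneg y]

/-- `R^e - R^{-e}`. -/
noncomputable def sinhTerm (e : ℕ) (R : ℝ) : ℝ := R ^ e - (R ^ e)⁻¹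

/-- `κ_m(v; R) = Σ_j |v_j| (R^{|j-m|} - R^{-|j-m|})`. -/
noncomputable def kappaR (v : List ℝ) (m : ℕ) (R : ℝ) : ℝ :=
  ∑ j ∈ Finset.range v.length, |v.getD j 0| * sinhTerm (Nat.dist j m) R

/-- `sinhTerm e R ≥ 0` for `R ≥ 1`. -/
theorem sinhTerm_nonneg (e : ℕ) {R : ℝ} (hR : 1 ≤ R) : 0 ≤ sinhTerm e R := by
  unfold sinhTerm
  have h1 : 1 ≤ R ^ e := one_le_pow₀ hR
  have h2 : (R ^ e)⁻¹ ≤ 1 := inv_le_one_of_one_le₀ h1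
  linarith

/-- `sinhTerm` is monotone on `[1, ∞)`. -/
theorem sinhTerm_mono (e : ℕ) {R S : ℝ} (hR : 1 ≤ R) (hRS : R ≤ S) : sinhTerm e R ≤ sinhTerm e S := by
  unfold sinhTerm
  have h1 : R ^ e ≤ S ^ e := pow_le_pow_left₀ (by linarith) hRS e
  have h2 : 0 < R ^ e := pow_pos (by linarith) e
  have h3 : (S ^ e)⁻¹ ≤ (R ^ e)⁻¹ := inv_anti₀ h2 h1
  linarith

/-- Superadditivity: `sinhTerm e (RS) ≥ sinhTerm e R + sinhTerm e S` for `R, S ≥ 1`. -/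
theorem sinhTerm_superadd (e : ℕ) {R S : ℝ} (hR : 1 ≤ R) (hS : 1 ≤ S) :
    sinhTerm e R + sinhTerm e S ≤ sinhTerm e (R * S) := by
  unfold sinhTerm
  have hx : 1 ≤ R ^ e := one_le_pow₀ hR
  have hy : 1 ≤ S ^ e := one_le_pow₀ hS
  rw [mul_pow]
  set x := R ^ e
  set y := S ^ e
  have hx0 : 0 < x := by linarith
  have hy0 : 0 < y := by linarith
  have hxy : 0 < x * y := mul_pos hx0 hy0
  have key : x * y - (x * y)⁻¹ - (x - x⁻¹ + (y - y⁻¹)) = (x - 1) * (y - 1) * (x * y - 1) / (x * y) := by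
    field_simp
    ring
  have hnum : 0 ≤ (x - 1) * (y - 1) * (x * y - 1) := by
    apply mul_nonneg (mul_nonneg (by linarith) (by linarith)); nlinarith
  have : 0 ≤ x * y - (x * y)⁻¹ - (x - x⁻¹ + (y - y⁻¹)) := by rw [key]; positivity
  linarith

/-- `κ ≥ 0` on `[1, ∞)`. -/
theorem kappaR_nonneg (v : List ℝ) (m : ℕ) {R : ℝ} (hR : 1 ≤ R) : 0 ≤ kappaR v m R :=
  Finset.sum_nonneg fun _ _ => mul_nonneg (abs_nonneg _) (sinhTerm_nonneg _ hR)

/-- `κ` is monotone on `[1, ∞)`. -/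
theorem kappaR_mono (v : List ℝ) (m : ℕ) {R S : ℝ} (hR : 1 ≤ R) (hRS : R ≤ S) : kappaR v m R ≤ kappaR v m S :=
  Finset.sum_le_sum fun _ _ => mul_le_mul_of_nonneg_left (sinhTerm_mono _ hR hRS) (abs_nonneg _)

/-- `κ` is superadditive on `[1, ∞)`. -/
theorem kappaR_superadd (v : List ℝ) (m : ℕ) {R S : ℝ} (hR : 1 ≤ R) (hS : 1 ≤ S) :
    kappaR v m R + kappaR v m S ≤ kappaR v m (R * S) := by
  unfold kappaR
  rw [← Finset.sum_add_distrib]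
  apply Finset.sum_le_sum
  intro j _
  rw [← mul_add]
  exact mul_le_mul_of_nonneg_left (sinhTerm_superadd _ hR hS) (abs_nonneg _)

/-- `Σ_{α} κ(R_α)² ≤ κ(∏ R_α)²` for `R_α ≥ 1`. -/
theorem sum_kappaR_sq_le (v : List ℝ) (m : ℕ) (t : Multiset ℝ) (ht : ∀ R ∈ t, 1 ≤ R) :
    (t.map fun R => kappaR v m R ^ 2).sum ≤ kappaR v m t.prod ^ 2 := by
  induction t using Multiset.induction_on with
  | empty =>
    simp only [Multiset.map_zero, Multiset.sum_zero, Multiset.prod_zero]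
    positivity
  | cons R u ih =>
    have hR : 1 ≤ R := ht R (Multiset.mem_cons_self R u)
    have hu : ∀ S ∈ u, 1 ≤ S := fun S hS => ht S (Multiset.mem_cons_of_mem hS)
    have hu1 : 1 ≤ u.prod := one_le_multiset_prod hu
    rw [Multiset.map_cons, Multiset.sum_cons, Multiset.prod_cons]
    have h1 := kappaR_superadd v m hR hu1
    have h2 := kappaR_nonneg v m hR
    have h3 := kappaR_nonneg v m hu1
    have h4 := ih hu
    nlinarith

/-- For `α ≠ 0`: `‖α^j (α^m)⁻¹‖` and its inverse differ by `sinhTerm |j-m| (max ‖α‖ ‖α‖⁻¹)` in absolute value. -/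
theorem abs_norm_sub_inv_eq_sinhTerm {α : ℂ} (hα : α ≠ 0) (j m : ℕ) :
    |‖α ^ j * (α ^ m)⁻¹‖ - ‖α ^ j * (α ^ m)⁻¹‖⁻¹| = sinhTerm (Nat.dist j m) (max ‖α‖ ‖α‖⁻¹) := by
  have hr : 0 < ‖α‖ := norm_pos_iff.mpr hα
  set r := ‖α‖ with hrdef
  have hw : ‖α ^ j * (α ^ m)⁻¹‖ = r ^ j * (r ^ m)⁻¹ := by rw [norm_mul, norm_inv, norm_pow, norm_pow]
  rw [hw, mul_inv, inv_inv]
  -- symmetric expression `|r^j/r^m - r^m/r^j|`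
  have key : ∀ (a b : ℕ) (ρ : ℝ), 0 < ρ → a ≤ b →
      |ρ ^ a * (ρ ^ b)⁻¹ - (ρ ^ a)⁻¹ * ρ ^ b| = |ρ ^ (b - a) - (ρ ^ (b - a))⁻¹| := by
    intro a b ρ hρ hab
    obtain ⟨c, rfl⟩ := Nat.exists_eq_add_of_le hab
    rw [Nat.add_sub_cancel_left, pow_add]
    have hρa : ρ ^ a ≠ 0 := pow_ne_zero _ hρ.ne'
    have hρc : ρ ^ c ≠ 0 := pow_ne_zero _ hρ.ne'
    rw [show ρ ^ a * (ρ ^ a * ρ ^ c)⁻¹ - (ρ ^ a)⁻¹ * (ρ ^ a * ρ ^ c) = -(ρ ^ c - (ρ ^ c)⁻¹) by field_simp; ring,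
      abs_neg]
  have hsym : ∀ (c : ℕ), |r ^ c - (r ^ c)⁻¹| = sinhTerm c (max r r⁻¹) := by
    intro c
    unfold sinhTerm
    rcases le_or_gt 1 r with h1 | h1
    · rw [max_eq_left ((inv_le_one_of_one_le₀ h1).trans h1)]
      exact abs_of_nonneg (by
        have : 1 ≤ r ^ c := one_le_pow₀ h1
        have : (r ^ c)⁻¹ ≤ 1 := inv_le_one_of_one_le₀ this
        linarith)
    · have hinv : 1 ≤ r⁻¹ := one_le_inv_iff₀.mpr ⟨hr, h1.le⟩
      rw [max_eq_right (h1.le.trans hinv), inv_pow, inv_inv]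
      have : r ^ c ≤ 1 := pow_le_one₀ hr.le h1.le
      have hc0 : 0 < r ^ c := pow_pos hr c
      have : 1 ≤ (r ^ c)⁻¹ := one_le_inv_iff₀.mpr ⟨hc0, this⟩
      rw [abs_of_nonpos (by linarith)]; ring
  rcases le_total j m with hjm | hmj
  · rw [key j m r hr hjm, hsym, Nat.dist_eq_sub_of_le hjm]
  · rw [show r ^ j * (r ^ m)⁻¹ - (r ^ j)⁻¹ * r ^ m = -(r ^ m * (r ^ j)⁻¹ - (r ^ m)⁻¹ * r ^ j) by ring, abs_neg,
      key m j r hr hmj, hsym, Nat.dist_comm, Nat.dist_eq_sub_of_le hmj]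

/-- **The defect bound.** For `α ≠ 0`, `q̂(α) = V(α)V(α⁻¹)` satisfies
`‖q̂(α)‖ - Re q̂(α) ≤ ½ κ_m(max(‖α‖,‖α‖⁻¹))²`. -/
theorem norm_sub_re_laurent_le (v : List ℝ) (m : ℕ) {α : ℂ} (hα : α ≠ 0) :
    ‖vEval v α * vEval v α⁻¹‖ - (vEval v α * vEval v α⁻¹).re ≤ kappaR v m (max ‖α‖ ‖α‖⁻¹) ^ 2 / 2 := by
  set a := vEval v α with ha
  set b := vEval v ((starRingEnd ℂ) α)⁻¹ with hb
  have hqb : vEval v α⁻¹ = (starRingEnd ℂ) b := by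
    rw [hb, conj_vEval, map_inv₀, Complex.conj_conj]
  have hαm : α ^ m ≠ 0 := pow_ne_zero _ hα
  set γ : ℂ := (α ^ m)⁻¹ with hγ
  set γ' : ℂ := ((starRingEnd ℂ) α) ^ m with hγ'
  have hγγ : γ * (starRingEnd ℂ) γ' = 1 := by
    rw [hγ, hγ', map_pow, Complex.conj_conj, inv_mul_cancel₀ hαm]
  have h1 := norm_mul_norm_sub_re_le a b γ γ' hγγ
  rw [hqb, norm_mul, Complex.norm_conj]
  refine h1.trans ?_
  -- `aγ - bγ' = Σ_j v_j (w_j - conj(w_j⁻¹))`, `w_j = α^j (α^m)⁻¹`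
  have hdiff : a * γ - b * γ' = ∑ j ∈ Finset.range v.length,
      ((v.getD j 0 : ℝ) : ℂ) * (α ^ j * (α ^ m)⁻¹ - (starRingEnd ℂ) (α ^ j * (α ^ m)⁻¹)⁻¹) := by
    rw [ha, hb, vEval_eq_sum, vEval_eq_sum, Finset.sum_mul, Finset.sum_mul, ← Finset.sum_sub_distrib]
    apply Finset.sum_congr rfl
    intro j _
    rw [hγ, hγ', mul_inv, inv_inv, map_mul, map_inv₀, map_pow, map_pow, inv_pow]
    ring
  have hnorm : ‖a * γ - b * γ'‖ ≤ kappaR v m (max ‖α‖ ‖α‖⁻¹) := by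
    rw [hdiff]
    refine (norm_sum_le _ _).trans ?_
    unfold kappaR
    apply Finset.sum_le_sum
    intro j _
    rw [norm_mul, Complex.norm_real, Real.norm_eq_abs,
      norm_sub_conj_inv (mul_ne_zero (pow_ne_zero _ hα) (inv_ne_zero hαm)), abs_norm_sub_inv_eq_sinhTerm hα]
  have hk0 : 0 ≤ ‖a * γ - b * γ'‖ := norm_nonneg _
  have := pow_le_pow_left₀ hk0 hnorm 2
  linarith

end Summit.Ventures.DiscreteObjects.Mahler
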